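import Mathlib.Algebra.Homology.DerivedCategory.Ext.MapBijective
import HarnessLib

/-!
# Venture HSemireg — the ADJUNCTION ISOMORPHISM on `Ext` for an exact adjoint pair, and the factorisation of
# `Ext` along the forgetful functor through it (PLAN-W1-TW item T-8 (b); w1-tw-1 gen 3)

HONEST FRAMING. Pure homological algebra with Mathlib's `Abelian.Ext` (`Ext.mapExactFunctor`, `ShortExact.extClass`,
the covariant long exact sequences, `Injective.injective_of_adjoint`): no derived category is handled by hand, no gerbe,
no group action, no sheaf and no semiregularity map is constructed; nothing here says that HC, HC_CM or HC_AV holds, and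
nothing here is a new case of anything.

## The step being served

The twisted dictionary of the cell (`run/shared/lean/pub/pub-hsemireg/widen/W1/TW-EQ-w1tw1.md` THEOREM TW-EQ (ii),
`W1-TW2-FOUNDATIONS.md` §3) reads `Ext_α(E,E) = (Ext_{A₁}(N,N))^G`. Its kernel bookkeeping (T-8 (b)) in carrier-free
form: `U : C ⥤ D` the forgetful functor from the equivariant (≃ twisted) category to the cover, `R : D ⥤ C` its right
adjoint (co-induction `⊕_g g^*`), both EXACT. In the tree: `U` is injective on `Ext` when the unit splits
(`EquivariantExtEmbedding.lean`, w1-tw-2) and the range of `· ≫ η_Y : Extⁿ_C(X,Y) → Extⁿ_C(X, R U Y)` is the invariants of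
the Mackey action (`EquivariantExtAverage.lean`). This file supplies the link between the two targets. As in
`EquivariantExtEmbedding.lean` the unit / counit enter as honest FAMILIES of morphisms `η_Y : Y ⟶ R (U Y)`,
`ε_{Y'} : U (R Y') ⟶ Y'` with the needed identities as hypotheses (naturality of `ε`, the left triangle identity, the
degree-`0` adjunction bijection, «`R` preserves injectives»), and the final items specialise them to Mathlib's `U ⊣ R`.

* `Φ : Extⁿ_C(X, R Y') → Extⁿ_D(U X, Y')`, `Φ(x) = U(x) ≫ ε_{Y'}` — written out in every statement, no definition is
  introduced — **is a BIJECTION** for all `X`, `Y'`, `n` (`comp_eps_bijective`, `comp_counit_bijective`; `D` with enough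
  injectives). Degree `0` is the adjunction bijection; the inductive step (`comp_eps_bijective_step`) is dimension shifting
  along an injective presentation `0 → Y' → I → Q → 0` in `D`: `R` is exact and preserves injectives
  (`Injective.injective_of_adjoint`, `U` exact), `Φ` is natural in `Y'` (`comp_eps_comp_mk₀`) and commutes with the
  connecting classes (`comp_eps_comp_extClass`: `Ext.mapExactFunctor_extClass` + `extClass_naturality` for the morphism of
  short exact sequences `ε : U R S → S`), and the four-term exact sequences on both sides do the rest;
  `mapExactFunctor_injective_of_retraction` / `mapExtAddHom_injective_of_retraction'` re-derive w1-tw-2's injectivity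
  through `Φ` (same maps, second route).
* `comp_eps_comp_eta` / `comp_counit_comp_unit` — **`Φ(y ≫ η_Y) = U(y)`** (left triangle identity): Mathlib's
  `U.mapExtAddHom` FACTORS as `Extⁿ_C(X,Y) —(· ≫ η_Y)→ Extⁿ_C(X, R U Y) —Φ, ≅→ Extⁿ_D(U X, U Y)`.
So, with the two companion files: `Extⁿ_C(X,Y) ↪ Extⁿ_D(U X, U Y)` has image `Φ`(the `τ`-invariants of `Extⁿ_C(X, R U Y)`),
all abstractly; what remains MODEL-level for the cell (no carrier for equivariant / twisted sheaves in the tree) is T-8 (a)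
(the descent equivalence for the isogeny) and the Mackey identities `R U ≅ (·) ⊗ k[G]` with `τ_g` = conjugation by the
linearisations, under which «`τ`-invariants» reads «`G`-invariants of `Extⁿ_{A₁}(N,N)`».

## References (printed form of the mechanism; nothing below is used in the proofs)

* U. Görtz, T. Wedhorn, *Algebraic Geometry II*, App. F, Prop. F.191 / Rem. F.190 (adjoint pairs on complexes and derived
  categories; = Lipman (3.2.1)–(3.2.2)), Cor. F.183 (a functor with an exact left adjoint preserves injectives).
  [GortzWedhorn2023]
* R.-O. Buchweitz, H. Flenner, Compositio Math. 137 (2003), §5. [BuchweitzFlenner2003]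
-/

noncomputable section

open CategoryTheory CategoryTheory.Abelian CategoryTheory.Limits

namespace Summit.Ventures.HSemireg.EquivariantExtAdjunction

universe w w' v v' u u'

variable {C : Type u} [Category.{v} C] [Abelian C] {D : Type u'} [Category.{v'} D] [Abelian D]
  (U : C ⥤ D) (R : D ⥤ C) [U.Additive] [R.Additive]
  [PreservesFiniteLimits U] [PreservesFiniteColimits U] [PreservesFiniteLimits R] [PreservesFiniteColimits R]
  [HasExt.{w} C] [HasExt.{w'} D]
  (ε : ∀ Y' : D, U.obj (R.obj Y') ⟶ Y')
  (hε : ∀ ⦃Y' Y'' : D⦄ (g : Y' ⟶ Y''), U.map (R.map g) ≫ ε Y'' = ε Y' ≫ g)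

/-! ### The map `Φ(x) = U(x) ≫ ε` for a natural family `ε : U R ⟶ 𝟭` -/

omit [R.Additive] [PreservesFiniteLimits R] [PreservesFiniteColimits R] in
/-- **Degree `0`:** `Φ(mk₀ f) = mk₀ (U f ≫ ε_{Y'})`. [folklore] -/
theorem mapExactFunctor_mk₀_comp_eps {X : C} {Y' : D} (f : X ⟶ R.obj Y') :
    ((Ext.mk₀ f).mapExactFunctor U).comp (Ext.mk₀ (ε Y')) (add_zero 0) = Ext.mk₀ (U.map f ≫ ε Y') := by
  rw [Ext.mapExactFunctor_mk₀, Ext.mk₀_comp_mk₀]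

omit [R.Additive] [PreservesFiniteLimits R] [PreservesFiniteColimits R] in
include hε in
/-- **`Φ` is natural in `Y'`:** `Φ(x ≫ R g) = Φ(x) ≫ g` for `g : Y' ⟶ Y''` (naturality of `ε`). [folklore] -/
theorem comp_eps_comp_mk₀ {X : C} {Y' Y'' : D} (g : Y' ⟶ Y'') {n : ℕ} (x : Ext X (R.obj Y') n) :
    ((x.comp (Ext.mk₀ (R.map g)) (add_zero n)).mapExactFunctor U).comp (Ext.mk₀ (ε Y'')) (add_zero n) =
      ((x.mapExactFunctor U).comp (Ext.mk₀ (ε Y')) (add_zero n)).comp (Ext.mk₀ g) (add_zero n) := by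
  rw [Ext.mapExactFunctor_comp, Ext.mapExactFunctor_mk₀, Ext.comp_assoc_of_third_deg_zero, Ext.mk₀_comp_mk₀,
    Ext.comp_assoc_of_third_deg_zero, Ext.mk₀_comp_mk₀, hε]

omit [PreservesFiniteLimits R] [PreservesFiniteColimits R] in
include hε in
/-- **`Φ` commutes with connecting classes.** For a short exact `S` in `D`, its image `R S` (written as the explicit
short complex `R S.X₁ → R S.X₂ → R S.X₃`, short exact since `R` is exact) and `x ∈ Extⁿ_C(X, R S.X₃)`:
`Φ(x ≫ δ_{R S}) = Φ(x) ≫ δ_S` in `Extⁿ⁺¹_D(U X, S.X₁)` — `U(δ_{R S}) = δ_{U R S}` (`Ext.mapExactFunctor_extClass`) and `δ` is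
natural along the morphism of short exact sequences `ε : U R S → S` (`extClass_naturality`). [folklore] -/
theorem comp_eps_comp_extClass {X : C} {S : ShortComplex D} (hS : S.ShortExact)
    (hT : (ShortComplex.mk (R.map S.f) (R.map S.g)
      (by rw [← Functor.map_comp, S.zero, Functor.map_zero]) : ShortComplex C).ShortExact)
    {n : ℕ} (x : Ext X (R.obj S.X₃) n) :
    ((x.comp hT.extClass (rfl : n + 1 = n + 1)).mapExactFunctor U).comp (Ext.mk₀ (ε S.X₁)) (add_zero (n + 1)) =
      ((x.mapExactFunctor U).comp (Ext.mk₀ (ε S.X₃)) (add_zero n)).comp hS.extClass (rfl : n + 1 = n + 1) := by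
  -- `ε` on the three terms is a morphism of short exact sequences `U(R(S)) → S`
  let τ : (ShortComplex.mk (R.map S.f) (R.map S.g)
      (by rw [← Functor.map_comp, S.zero, Functor.map_zero]) : ShortComplex C).map U ⟶ S :=
    { τ₁ := ε S.X₁, τ₂ := ε S.X₂, τ₃ := ε S.X₃, comm₁₂ := (hε S.f).symm, comm₂₃ := (hε S.g).symm }
  have hnat := (hT.map_of_exact U).extClass_naturality hS τ
  have e2 : (hT.extClass).mapExactFunctor U = (hT.map_of_exact U).extClass := Ext.mapExactFunctor_extClass U hT
  have inner : ((hT.extClass).mapExactFunctor U).comp (Ext.mk₀ (ε S.X₁)) (add_zero 1) =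
      (Ext.mk₀ (ε S.X₃) : Ext (U.obj (R.obj S.X₃)) S.X₃ 0).comp hS.extClass (zero_add 1) := by
    rw [e2]
    exact hnat
  rw [Ext.mapExactFunctor_comp, Ext.comp_assoc_of_third_deg_zero, inner, ← Ext.comp_assoc_of_second_deg_zero]

/-! ### Bijectivity of `Φ` by dimension shifting -/

include hε in
/-- **One step of dimension shifting.** For a short exact `0 → S.X₁ → S.X₂ → S.X₃ → 0` in `D` with `S.X₂` and `R S.X₂`
injective: if `Φ` is injective in degree `n` at `S.X₃` and surjective in degree `n` at `S.X₂` and at `S.X₃`, then `Φ` is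
bijective in degree `n + 1` at `S.X₁`. (`Extⁿ⁺¹` into an injective vanishes on both sides; chase the four-term exact
sequences with `comp_eps_comp_extClass` and `comp_eps_comp_mk₀`.) [folklore] -/
theorem comp_eps_bijective_step {X : C} {S : ShortComplex D} (hS : S.ShortExact) [Injective S.X₂]
    [Injective (R.obj S.X₂)] {n : ℕ}
    (inj₃ : Function.Injective
      (fun x : Ext X (R.obj S.X₃) n => (x.mapExactFunctor U).comp (Ext.mk₀ (ε S.X₃)) (add_zero n)))
    (surj₂ : Function.Surjective
      (fun x : Ext X (R.obj S.X₂) n => (x.mapExactFunctor U).comp (Ext.mk₀ (ε S.X₂)) (add_zero n)))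
    (surj₃ : Function.Surjective
      (fun x : Ext X (R.obj S.X₃) n => (x.mapExactFunctor U).comp (Ext.mk₀ (ε S.X₃)) (add_zero n))) :
    Function.Bijective
      (fun x : Ext X (R.obj S.X₁) (n + 1) => (x.mapExactFunctor U).comp (Ext.mk₀ (ε S.X₁)) (add_zero (n + 1))) := by
  -- `R(S)` as an explicit short complex of `C`, short exact since `R` is exact
  have hT : (ShortComplex.mk (R.map S.f) (R.map S.g)
      (by rw [← Functor.map_comp, S.zero, Functor.map_zero]) : ShortComplex C).ShortExact := hS.map_of_exact R
  -- the map in degree `n + 1` at `S.X₁`, as an additive map (for the reduction of injectivity to zero detection)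
  obtain ⟨G, hG⟩ : ∃ G : Ext X (R.obj S.X₁) (n + 1) →+ Ext (U.obj X) S.X₁ (n + 1),
      ∀ x, G x = (x.mapExactFunctor U).comp (Ext.mk₀ (ε S.X₁)) (add_zero (n + 1)) :=
    ⟨((Ext.mk₀ (ε S.X₁)).postcomp (U.obj X) (add_zero (n + 1))).comp (U.mapExtAddHom X (R.obj S.X₁) (n + 1)),
      fun x => rfl⟩
  constructor
  · -- injectivity = zero detection
    have key : ∀ x : Ext X (R.obj S.X₁) (n + 1),
        (x.mapExactFunctor U).comp (Ext.mk₀ (ε S.X₁)) (add_zero (n + 1)) = 0 → x = 0 := by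
      intro x hx
      obtain ⟨x₃, rfl⟩ : ∃ x₃ : Ext X (R.obj S.X₃) n, x₃.comp hT.extClass rfl = x :=
        Ext.covariant_sequence_exact₁ X hT x (Ext.eq_zero_of_injective _) rfl
      have h3 : ((x₃.mapExactFunctor U).comp (Ext.mk₀ (ε S.X₃)) (add_zero n)).comp hS.extClass
          (rfl : n + 1 = n + 1) = 0 :=
        (comp_eps_comp_extClass U R ε hε hS hT x₃).symm.trans hx
      obtain ⟨w, hw⟩ := Ext.covariant_sequence_exact₃ (U.obj X) hS _ rfl h3
      obtain ⟨w', rfl⟩ := surj₂ w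
      have hx₃ : x₃ = w'.comp (Ext.mk₀ (R.map S.g)) (add_zero n) :=
        inj₃ (hw.symm.trans (comp_eps_comp_mk₀ U R ε hε S.g w').symm)
      subst hx₃
      rw [Ext.comp_assoc_of_second_deg_zero, hT.comp_extClass, Ext.comp_zero]
    intro x₁ x₂ h
    have h0 : G (x₁ - x₂) = 0 := by rw [map_sub, hG, hG, sub_eq_zero]; exact h
    exact sub_eq_zero.mp (key _ ((hG _).symm.trans h0))
  · -- surjectivity: dimension shifting
    intro y
    obtain ⟨y₃, rfl⟩ : ∃ y₃ : Ext (U.obj X) S.X₃ n, y₃.comp hS.extClass rfl = y :=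
      Ext.covariant_sequence_exact₁ (U.obj X) hS y (Ext.eq_zero_of_injective _) rfl
    obtain ⟨x₃, rfl⟩ := surj₃ y₃
    exact ⟨x₃.comp hT.extClass rfl, comp_eps_comp_extClass U R ε hε hS hT x₃⟩

include hε in
/-- **`Φ` is a bijection in every degree** once it is one in degree `0` on plain morphisms (the adjunction bijection
`f ↦ U f ≫ ε`), `R` preserves injectives, and `D` has enough injectives: induction on `n` for all `Y'` at once along
injective presentations `0 → Y' → I → Q → 0` (`comp_eps_bijective_step`). [folklore] -/
theorem comp_eps_bijective [EnoughInjectives D] (hR : ∀ J : D, Injective J → Injective (R.obj J)) (X : C)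
    (h0 : ∀ Y' : D, Function.Bijective (fun f : X ⟶ R.obj Y' => U.map f ≫ ε Y')) (Y' : D) (n : ℕ) :
    Function.Bijective (fun x : Ext X (R.obj Y') n => (x.mapExactFunctor U).comp (Ext.mk₀ (ε Y')) (add_zero n)) := by
  induction n generalizing Y' with
  | zero =>
    constructor
    · intro x₁ x₂ h
      obtain ⟨f₁, rfl⟩ := (Ext.mk₀_bijective X (R.obj Y')).2 x₁
      obtain ⟨f₂, rfl⟩ := (Ext.mk₀_bijective X (R.obj Y')).2 x₂
      simp only [mapExactFunctor_mk₀_comp_eps] at h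
      rw [(h0 Y').1 ((Ext.mk₀_bijective _ _).1 h)]
    · intro y
      obtain ⟨g, rfl⟩ := (Ext.mk₀_bijective (U.obj X) Y').2 y
      obtain ⟨f, hf⟩ := (h0 Y').2 g
      exact ⟨Ext.mk₀ f, by simp only [mapExactFunctor_mk₀_comp_eps]; rw [← hf]⟩
  | succ n ih =>
    -- an injective presentation `0 → Y' → I.J → cokernel → 0`
    let I : InjectivePresentation Y' := (EnoughInjectives.presentation Y').some
    haveI : Injective (ShortComplex.mk I.f (cokernel.π I.f) (cokernel.condition I.f)).X₂ := I.injective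
    haveI : Injective (R.obj (ShortComplex.mk I.f (cokernel.π I.f) (cokernel.condition I.f)).X₂) :=
      hR _ I.injective
    exact comp_eps_bijective_step U R ε hε (S := ShortComplex.mk I.f (cokernel.π I.f) (cokernel.condition I.f))
      { exact := ShortComplex.exact_cokernel I.f } (ih _).1 (ih _).2 (ih _).2

/-! ### The unit side: `Φ(y ≫ η) = U(y)` -/

omit [R.Additive] [PreservesFiniteLimits R] [PreservesFiniteColimits R] in
/-- **`Φ(y ≫ η_Y) = U(y)`** under the left triangle identity `U(η_Y) ≫ ε_{U Y} = 𝟙`: Mathlib's `Ext.mapExactFunctor U`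
on `Extⁿ_C(X,Y)` factors through `· ≫ η_Y : Extⁿ_C(X,Y) → Extⁿ_C(X, R U Y)` followed by `Φ`. [folklore] -/
theorem comp_eps_comp_eta (η : ∀ Y : C, Y ⟶ R.obj (U.obj Y)) (tri : ∀ Y : C, U.map (η Y) ≫ ε (U.obj Y) = 𝟙 (U.obj Y))
    {X Y : C} {n : ℕ} (y : Ext X Y n) :
    ((y.comp (Ext.mk₀ (η Y)) (add_zero n)).mapExactFunctor U).comp (Ext.mk₀ (ε (U.obj Y))) (add_zero n) =
      y.mapExactFunctor U := by
  rw [Ext.mapExactFunctor_comp, Ext.mapExactFunctor_mk₀, Ext.comp_assoc_of_third_deg_zero, Ext.mk₀_comp_mk₀, tri,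
    Ext.comp_mk₀_id]

omit [R.Additive] [PreservesFiniteLimits R] [PreservesFiniteColimits R] in
/-- **Injectivity of `U` on `Ext` re-derived through `Φ`.** If moreover `η_Y` has a retraction `r` (`η_Y ≫ r = 𝟙`) and
`Φ` is injective on `Extⁿ_C(X, R U Y)`, then `Ext.mapExactFunctor U` is injective on `Extⁿ_C(X,Y)` — the statement of
`EquivariantExtEmbedding.lean` (w1-tw-2) by the route «`· ≫ η_Y` injective, then `Φ`», recorded to certify that the three
files speak about the same maps. [folklore] -/
theorem mapExactFunctor_injective_of_retraction (η : ∀ Y : C, Y ⟶ R.obj (U.obj Y))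
    (tri : ∀ Y : C, U.map (η Y) ≫ ε (U.obj Y) = 𝟙 (U.obj Y)) {Y : C} (r : R.obj (U.obj Y) ⟶ Y) (hr : η Y ≫ r = 𝟙 Y)
    (X : C) (n : ℕ)
    (hΦ : Function.Injective
      (fun x : Ext X (R.obj (U.obj Y)) n => (x.mapExactFunctor U).comp (Ext.mk₀ (ε (U.obj Y))) (add_zero n))) :
    Function.Injective (fun y : Ext X Y n => y.mapExactFunctor U) := by
  intro y₁ y₂ h
  have h1 := comp_eps_comp_eta U R ε η tri y₁
  have h2 := comp_eps_comp_eta U R ε η tri y₂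
  have key : ∀ y : Ext X Y n, (y.comp (Ext.mk₀ (η Y)) (add_zero n)).comp (Ext.mk₀ r) (add_zero n) = y :=
    fun y => by rw [Ext.comp_assoc_of_third_deg_zero, Ext.mk₀_comp_mk₀, hr, Ext.comp_mk₀_id]
  have h' : y₁.comp (Ext.mk₀ (η Y)) (add_zero n) = y₂.comp (Ext.mk₀ (η Y)) (add_zero n) := by
    apply hΦ
    change ((y₁.comp (Ext.mk₀ (η Y)) (add_zero n)).mapExactFunctor U).comp (Ext.mk₀ (ε (U.obj Y))) (add_zero n) =
      ((y₂.comp (Ext.mk₀ (η Y)) (add_zero n)).mapExactFunctor U).comp (Ext.mk₀ (ε (U.obj Y))) (add_zero n)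
    rw [h1, h2]
    exact h
  rw [← key y₁, ← key y₂, h']

/-! ### Specialisation to Mathlib's adjunction `U ⊣ R` -/

/-- **The adjunction isomorphism on `Ext` (T-8 (b), the link).** For an adjunction `U ⊣ R` of EXACT additive functors
between abelian categories (`D` with enough injectives), `x ↦ U(x) ≫ ε_{Y'}` (`ε` the counit) is a bijection
`Extⁿ_C(X, R Y') → Extⁿ_D(U X, Y')` for every `X`, `Y'`, `n`. In the cell's reading (`U` forgetful from `G̃`-equivariant
sheaves on the cover to plain sheaves, `R = ⊕_g g^*`): `Extⁿ_C(X, R U Y) ≅ Extⁿ_{A₁}(U X, U Y)`.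
[cite: GortzWedhorn2023, Prop. F.191 and Cor. F.183] -/
theorem comp_counit_bijective [EnoughInjectives D] (adj : U ⊣ R) (X : C) (Y' : D) (n : ℕ) :
    Function.Bijective (fun x : Ext X (R.obj Y') n =>
      (x.mapExactFunctor U).comp (Ext.mk₀ (adj.counit.app Y')) (add_zero n)) := by
  refine comp_eps_bijective U R (fun Z => adj.counit.app Z) (fun _ _ g => adj.counit_naturality g)
    (fun J _ => Injective.injective_of_adjoint adj J) X (fun Z => ?_) Y' n
  have hfun : (fun f : X ⟶ R.obj Z => U.map f ≫ adj.counit.app Z) = ⇑(adj.homEquiv X Z).symm :=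
    funext fun f => by simp [Adjunction.homEquiv_symm_apply]
  exact hfun ▸ (adj.homEquiv X Z).symm.bijective

omit [R.Additive] [PreservesFiniteLimits R] [PreservesFiniteColimits R] in
/-- **`Φ(y ≫ η_Y) = U(y)`** for the unit and counit of `U ⊣ R`: `U.mapExtAddHom X Y n` factors through
`· ≫ η_Y : Extⁿ_C(X,Y) → Extⁿ_C(X, R U Y)` followed by the bijection of `comp_counit_bijective`. [folklore] -/
theorem comp_counit_comp_unit (adj : U ⊣ R) {X Y : C} {n : ℕ} (y : Ext X Y n) :
    ((y.comp (Ext.mk₀ (adj.unit.app Y)) (add_zero n)).mapExactFunctor U).comp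
        (Ext.mk₀ (adj.counit.app (U.obj Y))) (add_zero n) = U.mapExtAddHom X Y n y :=
  comp_eps_comp_eta U R (fun Z => adj.counit.app Z) (fun Z => adj.unit.app Z)
    (fun Z => adj.left_triangle_components Z) y

/-- **Corollary.** With a retraction `r` of the unit at `Y` (`η_Y ≫ r = 𝟙`, the averaging map when `|G|` is invertible),
`U.mapExtAddHom X Y n` is injective — `EquivariantExtEmbedding.mapExtAddHom_injective_of_adjunction_of_retraction`
(w1-tw-2) re-derived through the adjunction bijection. [folklore] -/
theorem mapExtAddHom_injective_of_retraction' [EnoughInjectives D] (adj : U ⊣ R) {Y : C}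
    (r : R.obj (U.obj Y) ⟶ Y) (hr : adj.unit.app Y ≫ r = 𝟙 Y) (X : C) (n : ℕ) :
    Function.Injective (U.mapExtAddHom X Y n) :=
  mapExactFunctor_injective_of_retraction U R (fun Z => adj.counit.app Z) (fun Z => adj.unit.app Z)
    (fun Z => adj.left_triangle_components Z) r hr X n (comp_counit_bijective U R adj X (U.obj Y) n).1

end Summit.Ventures.HSemireg.EquivariantExtAdjunction

end
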